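import Literature.MathematicalPhysics.QuantumFieldTheory.Balaban1983to89.B11Eq44COperatorTower

/-!
# `Balaban1983to89.B11Eq44COperatorTowerGeometric` — T. Bałaban, *Averaging operations for lattice gauge theories*, Commun. Math. Phys. **98** (1985) 17–51
# [Balaban1985Averaging] p. 37 (after (127)) *«the configurations Ū₀ʲ for j < k satisfy the assumptions of Proposition 3 for V₀ = Ū₀ʲ if α₀L^{2j}η² +
# 2C₀(α₀L^{2j}η²)² ≦ 2α₀L^{2j}η² < α₀»*, p. 25 (the block-loop display before (47), `O(1)L²α₀`), Proposition 2 (52)–(54) p. 26: **THE GEOMETRIC PER-LEVEL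
# REGULARITY PROFILE OF THE TOWER — `‖U^{(n)}(Γ) − 1‖ ≤ αT·L^{−2·min(n+1,k)}` at every block loop of the level-`n` background, and `Σ_{n<k} ≤ αT∕3`** —
# `B11Eq44COperatorTower.ulev_reg_of_pdev` (ne9-leaf-03 g55) keeps print's factor `(Lʲ∕Lᵏ)²` (its proof bounds it by `1`); consequence: the per-level data
# `(αU, Σ_{j<n+1} αU j ≤ AQ)` of the cell's MODEL block (X12 `B9Eq3152StoreyHClosedOnModel`, (K86), (T4B), …, whose suppliers carry `e^{100d(d+1)L^dAQ}` in
# the adjoint-averaging letter) are inhabitable with `AQ := αT∕3` INDEPENDENT OF THE HEIGHT `k` (with the constant profile `αT` only with `AQ = k·αT`);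
# STOREY I of the NE9 (117)∕(103) programme (the lattice-uniform `cur U` chart)

statement-level skeleton of published theorems with citation tags; proofs where landed; nothing here is a claim about the Yang–Mills mass gap

CITATION HEADER (lean-in-tree rule).  Audit cell `pub-balaban`, sub-cell `t4`, BINDER row NE9; NE9 crux-team LEAF PROVER 01 (`b2b-balaban-t4-ne9-formalise-leaf-01`, gen 96;
(I-6); bears_on: R4/N22).  Source read through the verbatim quotations of `B11Eq44COperatorTower` ∕ `B7Eq123General` (`paper:balaban1985-cmp98-averaging` pp. 25–26, 37).
The estimate is the crews' `B7Eq123General.level_data` + `blockLoops_of_pdev` (kernel theorems); this file only stops discarding the factor `(Lʲ∕Lᵏ)²` and sums it.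

WHAT IS PROVED (sorry-free; proof lane — 0 `def`; [folklore] bookkeeping on the crews' theorems).
* **`ulev_reg_of_pdev_geometric`** — under [4] Prop. 2's data on `Ũ` ((52) at height `k`, `G` averaging-closed, `C₀α₀ ≤ 1∕3`, `4α₀ ≤ c₂′`): for EVERY level `n`,
  `‖W(U^{(n)}; block loop) − 1‖ ≤ αT d L α₀ · ((L^{min(n+1,k)})⁻¹)²` (`n + 1 ≤ k`: `U^{(n)} = Ū^{k−1−n}`, factor `(L^{k−1−n}∕L^k)² = L^{−2(n+1)}`; junk levels
  `k ≤ n`: `U^{(n)} = Ũ`, factor `L^{−2k}`).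
* **`geomProfile_le_αT`**, **`geomProfile_nonneg`** — the profile is between `0` and the constant `αT` (so `≤ 1∕64` by `αT_le`, and the surjectivity regime
  `50(d+1)·αU·L^d ≤ 1∕2` follows from the constant one).
* **`sum_geomProfile_le`** — `Σ_{j<k} αT·((L^{min(j+1,k)})⁻¹)² ≤ αT∕3` (`L ≥ 2`: geometric series with ratio `L⁻² ≤ 1∕4`).
HONEST SCOPE.  [4] Prop. 2's hypotheses stay DISPLAYED; nothing of print asserted; constants crude.  NOT NE9 (cell pub-balaban: NE9 NOT PRINTED ∕ NOT PROVED; «NE9 ⇐ the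
named binders»; row WALLED ON A MODEL (O-NE9-1; #5 UNRULED); spine PROVED 0∕9; rung (B)+1 on a finite T⁴ — NOT infinite volume, NOT mass gap, NOT BetaPertH, NOT Clay;
HONEST DEPENDENCY: continuum YM on T⁴ ⇐ BetaPertH ∧ nine spine estimates (0/9 proved); BetaPertH ⇐ (D1) ∧ (D4) ∧ CAP+tail; G-an2-4 gates asym, D1 and NE2/3/4).
NEW file importing `B11Eq44COperatorTower` only; nothing modified.  Net new unproved facts: 0.
-/

noncomputable section

namespace Literature.MathematicalPhysics.QuantumFieldTheory.Balaban1983to89.B11Eq44COperatorTowerGeometric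

open scoped BigOperators
open B9Eq315QTorus (perSite perCfg perCfg_apply cornerSite)
open B9Eq315QTower (towerP towerP_apply UlevOf perCfg_UlevOf)
open B9SectCLatticeCarrier (Bond)
open B4Sect5Torus (TSite)
open B7Prop1Explicit (U1 Wcx boxVec)
open B7Prop2Explicit (pdev AvgClosed C0 c2' avgIter avgIter_zero)
open B7Eq123General (blockLoops_of_pdev level_data)
open B11Eq44COperatorTower (αT αT_le perCfg_UlevOf_of_le)

variable {d : ℕ} {𝔸 : Type*} [NormedRing 𝔸] [NormedAlgebra ℂ 𝔸] [CompleteSpace 𝔸] [NormOneClass 𝔸] (L : ℕ) [NeZero L] (m : Fin d → ℕ) [∀ i, NeZero (m i)]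
  (k : ℕ) (U : Bond d (towerP L m k) → 𝔸ˣ) (hL : 2 ≤ L) {G : Subgroup 𝔸ˣ} (hG : AvgClosed d L G)
  (hU : ∀ (x : B7Prop1Explicit.Site d) (κ : Fin d), perCfg (towerP L m k) U x κ ∈ G) {α₀ : ℝ} (hα : 0 < α₀)
  (hα3 : C0 d * α₀ ≤ 1 / 3) (hα4 : 4 * α₀ ≤ c2' d L) (h52 : pdev (perCfg (towerP L m k) U) < α₀ * (((L : ℝ) ^ k)⁻¹) ^ 2)

include hL hG hU hα hα3 hα4 h52 in
/-- **THE GEOMETRIC PER-LEVEL REGULARITY**: the block loops of the level-`n` background `U^{(n)} = UlevOf L m k U n` are within `αT·L^{−2·min(n+1,k)}` of `1`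
— p. 37's «2α₀L^{2j}η²» with `η = L^{−k}` KEPT (the crews' `level_data` at `j = k − 1 − n`, `blockLoops_of_pdev`), instead of `ulev_reg_of_pdev`'s `αT`.
[cite: Balaban1985Averaging, p.37 (after (127)), p.25 (displays before (47)), Proposition 2 (52)–(54) p.26] -/
theorem ulev_reg_of_pdev_geometric (n : ℕ) (y : TSite d (towerP L m n)) (κ : Fin d) (r : Fin d → Fin L) :
    ‖((Wcx L (perCfg (towerP L m (n + 1)) (UlevOf L m k U n)) (cornerSite L y) κ (boxVec L r) : 𝔸ˣ) : 𝔸) - 1‖ ≤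
      αT d L α₀ * (((L : ℝ) ^ min (n + 1) k)⁻¹) ^ 2 := by
  have hL1 : 1 ≤ L := le_trans (by norm_num) hL
  have hL0 : (0 : ℝ) < L := by exact_mod_cast lt_of_lt_of_le (by norm_num) hL
  by_cases hn : n + 1 ≤ k
  · obtain ⟨hV1, hβ0, hβ, hβmax⟩ := level_data L hL hG k _ hU hα hα3 hα4 h52 (k - 1 - n) (by omega)
    rw [Nat.min_eq_left hn, perCfg_UlevOf L m hn U]
    refine ((blockLoops_of_pdev hL1 hV1 hβ0 hβ hβmax (cornerSite L y) κ).1 r).trans (le_of_eq ?_)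
    have hrat : (L : ℝ) ^ (k - 1 - n) * ((L : ℝ) ^ k)⁻¹ = ((L : ℝ) ^ (n + 1))⁻¹ := by
      have hk : (L : ℝ) ^ k = (L : ℝ) ^ (k - 1 - n) * (L : ℝ) ^ (n + 1) := by rw [← pow_add]; congr 1; omega
      rw [hk, mul_inv, ← mul_assoc, mul_inv_cancel₀ (pow_ne_zero _ hL0.ne'), one_mul]
    rw [hrat]; unfold αT; ring
  · obtain ⟨hV1, hβ0, hβ, hβmax⟩ := level_data L hL hG k _ hU hα hα3 hα4 h52 0 (Nat.zero_le _)
    rw [avgIter_zero] at hV1 hβ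
    rw [Nat.min_eq_right (by omega), perCfg_UlevOf_of_le L m k U (by omega)]
    refine ((blockLoops_of_pdev hL1 hV1 hβ0 hβ hβmax (cornerSite L y) κ).1 r).trans (le_of_eq ?_)
    rw [pow_zero, one_mul]; unfold αT; ring

omit [NeZero L] in
/-- The profile is nonnegative. [cite: Balaban1985Averaging, p.37] -/
theorem geomProfile_nonneg (hα0 : 0 ≤ α₀) (j : ℕ) : 0 ≤ αT d L α₀ * (((L : ℝ) ^ min (j + 1) k)⁻¹) ^ 2 := by
  unfold αT; positivity

omit [NeZero L] in
/-- The profile is below the constant `αT` (`L ≥ 1`), so below `1∕64` (`αT_le`) and inside every regime stated for the constant profile. [cite: Balaban1985Averaging, p.37, p.25] -/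
theorem geomProfile_le_αT (hL1 : 1 ≤ L) (hα0 : 0 ≤ α₀) (j : ℕ) : αT d L α₀ * (((L : ℝ) ^ min (j + 1) k)⁻¹) ^ 2 ≤ αT d L α₀ := by
  have hT : 0 ≤ αT d L α₀ := by unfold αT; positivity
  have hL1' : (1 : ℝ) ≤ L := by exact_mod_cast hL1
  have h1 : ((L : ℝ) ^ min (j + 1) k)⁻¹ ≤ 1 := inv_le_one_of_one_le₀ (one_le_pow₀ hL1')
  have h2 : (((L : ℝ) ^ min (j + 1) k)⁻¹) ^ 2 ≤ 1 := pow_le_one₀ (by positivity) h1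
  exact (mul_le_mul_of_nonneg_left h2 hT).trans (le_of_eq (mul_one _))

omit [NeZero L] in
/-- **THE PROFILE IS SUMMABLE OVER THE LEVELS, UNIFORMLY IN THE HEIGHT**: `Σ_{j<k} αT·((L^{min(j+1,k)})⁻¹)² ≤ αT∕3` (`L ≥ 2`: the ratio `L⁻² ≤ 1∕4`) — the room
letter `AQ` of the MODEL block's `Σ_{j<n+1} αU j ≤ AQ` becomes height-free. [folklore] [cite: Balaban1985Averaging, p.37 (after (127))] -/
theorem sum_geomProfile_le (hL2 : 2 ≤ L) (hα0 : 0 ≤ α₀) :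
    ∑ j ∈ Finset.range k, αT d L α₀ * (((L : ℝ) ^ min (j + 1) k)⁻¹) ^ 2 ≤ αT d L α₀ / 3 := by
  have hT : 0 ≤ αT d L α₀ := by unfold αT; positivity
  have hL2' : (2 : ℝ) ≤ L := by exact_mod_cast hL2
  have hL0 : (0 : ℝ) < L := by linarith
  -- the terms inside the range: `min (j+1) k = j+1`, and `((L^{j+1})⁻¹)² = (L⁻²)^{j+1}`
  have hterm : ∀ j ∈ Finset.range k, αT d L α₀ * (((L : ℝ) ^ min (j + 1) k)⁻¹) ^ 2 = αT d L α₀ * (((L : ℝ) ^ 2)⁻¹) ^ (1 + j) := by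
    intro j hj
    rw [Finset.mem_range] at hj
    rw [Nat.min_eq_left (by omega), ← inv_pow, ← inv_pow, ← pow_mul, ← pow_mul]
    congr 2; ring
  rw [Finset.sum_congr rfl hterm, ← Finset.mul_sum]
  -- `Σ_{j<k} r^{1+j} = Σ_{i ∈ Ico 1 (k+1)} r^i ≤ r∕(1−r) ≤ 1∕3` for `r = L⁻² ≤ 1∕4`
  have hr0 : (0 : ℝ) ≤ ((L : ℝ) ^ 2)⁻¹ := by positivity
  have hr4 : ((L : ℝ) ^ 2)⁻¹ ≤ 1 / 4 := by
    rw [one_div]; exact inv_anti₀ (by norm_num) (by nlinarith)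
  have hr1 : ((L : ℝ) ^ 2)⁻¹ < 1 := lt_of_le_of_lt hr4 (by norm_num)
  have hsum : ∑ j ∈ Finset.range k, (((L : ℝ) ^ 2)⁻¹) ^ (1 + j) = ∑ i ∈ Finset.Ico 1 (k + 1), (((L : ℝ) ^ 2)⁻¹) ^ i := by
    rw [Finset.sum_Ico_eq_sum_range, show k + 1 - 1 = k from rfl]
  have hS : ∑ j ∈ Finset.range k, (((L : ℝ) ^ 2)⁻¹) ^ (1 + j) ≤ 1 / 3 := by
    rw [hsum]
    refine (geom_sum_Ico_le_of_lt_one hr0 hr1).trans ?_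
    rw [pow_one, div_le_iff₀ (by linarith)]
    nlinarith
  calc αT d L α₀ * ∑ j ∈ Finset.range k, (((L : ℝ) ^ 2)⁻¹) ^ (1 + j) ≤ αT d L α₀ * (1 / 3) := mul_le_mul_of_nonneg_left hS hT
    _ = αT d L α₀ / 3 := by ring

end Literature.MathematicalPhysics.QuantumFieldTheory.Balaban1983to89.B11Eq44COperatorTowerGeometric

end
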